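import Mathlib
import HarnessLib
import Summits.HubbardSuperconductivity.HubbardSuperconductivity.Theorems.KLProgrammeKLRegimeEngineV8TowerExports
import Summits.HubbardSuperconductivity.HubbardSuperconductivity.Theorems.KLProgrammeKLRegimeEngineScaleZeroV17FG8Q8U10L4

/-!
# K3 ENGINE-FLOW child (stmt-HubbardSuperconductivity-20437 `KLRegimeEngineV17F2`), v2 class #1: the `j = 0` BASE of the U-currency levels export —
# `LevelsUExportAt L M c P β U μ 0` from (E1-v4)₀ for every table dominating `Q.CE^p` (plan g17 (R47p): bases BY NAME, never an (a) conjunct)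

Cell `gate-hubbard-kl`, seat hubbard-kl-k3c2-p1 g5 (scale-`0` lane).  Class #1's step Prop `LevelsUStep P R Q₀ c u` (p5, `…EngineV8TowerExports`) at `n = 0`
has an EMPTY export history and asks `LevelsUExportAt L M c P β U μ 0` = the levelled U-currency sizes of the scale-`0` action at the bare frame
`K₀ = klFlowFrameU … 0 = 0` at the single level `j = 0`.  At `j = 0` every gain factor is `(2⁰)⁻¹ = 1`, `ε₀ = Klam·|U|`, and a prescription of leg
sectors only DROPS tuples (`klAnisoLegKernelNormAt_le`), so the base is (E1-v4)₀ — conjunct 1 of stub (a), PROVED (`stub_engine_scale0_klEng8Q8U10L4`) —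
read through a table domination `Q.CE^p ≤ c p` (`p ≥ 2`), which the producer of `LevelsUStep` discharges when it picks its deferred table `klCU`
(`LevelsUExportAt.mono`):

* `epsCoupling_zero` (`ε₀ = Klam·|U|`), **`levelsUAt_zero_of_kernelNormsV4`** (any frame `K`), `levelsUExportAt_zero_of_kernelNormsV4`;
* **`levelsUExportAt_zero_klEng8`** — under the v2 stub binders (`klEngC₃6`, `klEngU₀10`, `klEngL₄ P R`, `klEngM₃`, bare flow frame admissible), for every
  table `c` with `∀ p ≥ 2, (klEngQ8 P R).CE^p ≤ c p`: `LevelsUExportAt L M c P β U μ 0`.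

Bookkeeping; nothing about the model is asserted beyond the cited theorems; nothing asserts superconductivity.
-/

noncomputable section

namespace Summit.HubbardSuperconductivity.HubbardSuperconductivity.Theorems.EngineV8

set_option linter.dupNamespace false -- summit = problem name (single-conjunct summit), D-0017

open Real Finset Literature.MathematicalPhysics.QuantumLattice Literature.Probability.LatticeModels
open Summit.HubbardSuperconductivity.HubbardSuperconductivity.Theorems.KLRegimeSplit
open Summit.HubbardSuperconductivity.HubbardSuperconductivity.Theorems.KLProgrammeLegKernels

variable {L M : ℕ} [NeZero L]

/-- `ε₀ = Klam·|U|` (the scale-`0` coupling size of `KernelNormsV4`). -/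
theorem epsCoupling_zero (P : SplitConsts) (U : ℝ) : epsCoupling P U 0 = P.Klam * |U| := by
  simp [epsCoupling]

/-- **The levelled U-currency sizes at `j = 0` from (E1-v4)₀**, any frame `K`: `0 ≤ β`, `0 ≤ P.Klam`, `KernelNormsV4 L M P Q β U μ K 0` and a
table with `Q.CE^p ≤ c p` for `p ≥ 2` give `LevelsUAt L M c P β U μ K 0` (every gain factor is `1` at `j = 0`; prescriptions only drop tuples). -/
theorem levelsUAt_zero_of_kernelNormsV4 {c : ℕ → ℝ} {P : SplitConsts} {Q : EngConsts} {β U μ : ℝ} (hβ : 0 ≤ β) (hK : 0 ≤ P.Klam)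
    {K : TrigPolyC4v} (hE1 : KernelNormsV4 L M P Q β U μ K 0) (hc : ∀ p, 2 ≤ p → Q.CE ^ p ≤ c p) : LevelsUAt L M c P β U μ K 0 := by
  have hKU : 0 ≤ P.Klam * |U| := mul_nonneg hK (abs_nonneg U)
  refine ⟨fun Ωe => ?_, fun p hp Ωe => ?_⟩
  · have h := (klAnisoLegKernelNormAt_le (L := L) (M := M) hβ U μ K klE0 0 4 Ωe).trans (hE1 2 le_rfl)
    rw [epsCoupling_zero] at h
    simp only [Nat.cast_zero, mul_zero, zpow_zero, mul_one, show (2 : ℕ) - 1 = 1 from rfl, pow_one] at h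
    rw [pow_zero, mul_one]
    exact h.trans (mul_le_mul_of_nonneg_right (hc 2 le_rfl) hKU)
  · have h := (klAnisoLegKernelNormAt_le (L := L) (M := M) hβ U μ K klE0 0 (2 * p) Ωe).trans (hE1 p (by omega))
    rw [epsCoupling_zero] at h
    simp only [Nat.cast_zero, mul_zero, zpow_zero, mul_one] at h
    simp only [Nat.cast_zero, mul_zero, zpow_zero, mul_one, pow_zero, inv_one, one_pow]
    exact h.trans (mul_le_mul_of_nonneg_right (hc p (by omega)) (pow_nonneg hKU _))

/-- **The class-#1 export at `n = 0`** from (E1-v4)₀ at the bare flow frame `K₀ = klFlowFrameU L M β U μ 0`. -/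
theorem levelsUExportAt_zero_of_kernelNormsV4 [NeZero M] {c : ℕ → ℝ} {P : SplitConsts} {Q : EngConsts} {β U μ : ℝ} (hβ : 0 ≤ β)
    (hK : 0 ≤ P.Klam) (hE1 : KernelNormsV4 L M P Q β U μ (klFlowFrameU L M β U μ 0) 0) (hc : ∀ p, 2 ≤ p → Q.CE ^ p ≤ c p) :
    LevelsUExportAt L M c P β U μ 0 := by
  intro j hj
  obtain rfl : j = 0 := Nat.le_zero.1 hj
  exact levelsUAt_zero_of_kernelNormsV4 hβ hK hE1 hc

/-- **THE `j = 0` BASE OF CLASS #1 AT THE v2 STUB BINDERS**: for every `P R c` with `P.WF`, `R.WF2`, `0 < c ≤ klEngC₃6 P R`, `μ ∈ klWindowC`,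
`0 < U ≤ klEngU₀10 P R c`, `klBetaMin ≤ β ≤ e^{c/U²}`, volumes above `klEngL₄ P R β U` / `klEngM₃ β U L`, the bare flow frame admissible, and every table `c′` with
`∀ p ≥ 2, (klEngQ8 P R).CE^p ≤ c′ p`: `LevelsUExportAt L M c′ P β U μ 0` (conjunct 1 of the proved stub (a), `stub_engine_scale0_klEng8Q8U10L4`). -/
theorem levelsUExportAt_zero_klEng8 :
    ∀ (P : SplitConsts) (R : RenConsts) (c : ℝ), P.WF → R.WF2 → 0 < c → c ≤ klEngC₃6 P R →
      ∀ μ ∈ klWindowC, ∀ U : ℝ, 0 < U → U ≤ klEngU₀10 P R c → ∀ β : ℝ, klBetaMin ≤ β → β ≤ Real.exp (c / U ^ 2) →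
        ∀ (L M : ℕ) [NeZero L] [NeZero M], klEngL₄ P R β U ≤ L → klEngM₃ β U L ≤ M →
          FrameOK R U (nScales β) μ (klFlowFrameU L M β U μ 0) →
            ∀ c' : ℕ → ℝ, (∀ p, 2 ≤ p → (klEngQ8 P R).CE ^ p ≤ c' p) → LevelsUExportAt L M c' P β U μ 0 := by
  intro P R c hP hR hc hc₆ μ hμ U hU hU₁₀ β hβ hβc L M _ _ hL hM hK c' hc'
  have hE1 := (stub_engine_scale0_klEng8Q8U10L4 P R c hP hR hc hc₆ μ hμ U hU hU₁₀ β hβ hβc L M hL hM hK).1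
  have hβ0 : 0 ≤ β := le_trans (by norm_num [klBetaMin]) hβ
  exact levelsUExportAt_zero_of_kernelNormsV4 hβ0 (zero_le_one.trans hP.1) hE1 hc'

end Summit.HubbardSuperconductivity.HubbardSuperconductivity.Theorems.EngineV8

end
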